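/-
Copyright (c) 2026. All rights reserved.
Released under Apache 2.0 license as described in the file LICENSE.
Authors: abc-iut cell, seat abc-iut-f-069 (gen 5; row «DPSC-NODAL-MODEL», residual HFix).
-/
import Mathlib.GroupTheory.SemidirectProduct
import Mathlib.Algebra.BigOperators.Group.Finset.Piecewise
import Mathlib.Algebra.BigOperators.Pi
import Mathlib.Algebra.Group.Subgroup.Basic
import Mathlib.Algebra.Field.Basic
import Mathlib.Data.Fintype.Basic
import Mathlib.Tactic.Abel
import Mathlib.Tactic.Group
import Mathlib.Tactic.FinCases
import HarnessLib

/-!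
# Fox path chains: the Fox homomorphism `F(a,b) → (k^G × k^G) ⋊ G` and the coset-sum test

Lyndon–Schupp, *Combinatorial Group Theory*, Ch. II §3 (Fox calculus: the derivations `∂/∂x : F → ℤF`, the
fundamental formula `w - 1 = Σ_x (∂w/∂x)(x - 1)`, and their images in `ℤ[F/R]` — equivalently, the 1-chain of the
path of a word in the Cayley graph of a quotient `G = F/R`) [cite: LyndonSchupp2001, Ch. II §3].

GADGET + PROOF file (classical, self-contained; no `Prop` definitions, no instances, no notation), abc-iut-f-069
(gen 5).  For a group `G` and a commutative ring `k` we package the Fox derivations with values reduced to `G` as a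
homomorphism into the FINITE (when `G`, `k` are) group `W = (k^G × k^G) ⋊ G` (`G` acting by left translation),
so that they extend to profinite completions by the universal property:

* `FoxChain.rt h f = (q ↦ f (q h⁻¹))`, `FoxChain.lt g f = (q ↦ f (g⁻¹ q))` — right/left translation of a
  coefficient function `f : G → k` (the coefficients of `f·h`, `g·f` in `k[G]`); `FoxChain.e g` the indicator of `g`;
  `FoxChain.csum S` the coefficient sum over a finite set `S`;
* `FoxChain.foxAct`, `FoxChain.W G k = Multiplicative (k^G × k^G) ⋊ G`, the generators' images
  `FoxChain.wa A = ((𝟙,0), A)`, `FoxChain.wb B = ((0,𝟙), B)` (the Fox homomorphism of `F(a,b) → G`, `a ↦ A`,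
  `b ↦ B` is `FreeGroup.lift ![wa A, wb B]`);
* `FoxChain.pathSub A B` — the subgroup `{((f₁,f₂), q) : ρ_A f₁ - f₁ + ρ_B f₂ - f₂ = e_q - e_1}` of PATH CHAINS
  (the fundamental formula: the chain of a path from `1` to `q` has boundary `q - 1`), containing `wa A`, `wb B`;
* `FoxChain.thetaHom A B M` — the endomorphism `((f₁,f₂),q) ↦ ((f₁, f₂ + Σ_{j<M} ρ_{A B^j} f₁), q)` of `W`, which
  is what the substitution `a ↦ a b^M`, `b ↦ b` does to Fox chains when `B^M = 1` (`thetaHom_wa`, `thetaHom_wb`);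
* `FoxChain.mem_of_fox_chain` — **the coset-sum test**: over a field `k` with `(M : k) ≠ 0`, if a path chain
  `(f₁, f₂)` from `1` to `X` satisfies `Σ_{j<M} ρ_{A B^j} f₁ = 0`, then `X` lies in ANY subgroup `H ∋ B, A B A⁻¹`
  (apply the coefficient-sum functional of `H` — right-invariant under `B` and `A B A⁻¹` — to the boundary identity;
  the hypothesis kills the coefficient sums of `f₁` over `H` and over `H·A`).
This is the finite shadow of the Bass–Serre argument "a fixed vertex of the twisted tree adjacent to the base
vertex"; it is consumed by `AbsTopII/DehnTwistFixedSubgroup.lean` (fixed subgroup of the profinite Dehn twist).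
Classical combinatorial group theory; nothing here bears on [IUTchIII] Cor 3.12.
-/

namespace Literature.GroupTheory.CombinatorialGroupTheory.FoxChain

/-- Right translation of a coefficient function: `(ρ_h f)(q) = f (q h⁻¹)`. [cite: LyndonSchupp2001, Ch. II §3] -/
def rt {G : Type*} [Group G] {k : Type*} (h : G) (f : G → k) : G → k := fun q => f (q * h⁻¹)

/-- Left translation of a coefficient function: `(λ_g f)(q) = f (g⁻¹ q)`. [cite: LyndonSchupp2001, Ch. II §3] -/
def lt {G : Type*} [Group G] {k : Type*} (g : G) (f : G → k) : G → k := fun q => f (g⁻¹ * q)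

/-- The indicator of a group element. [cite: LyndonSchupp2001, Ch. II §3] -/
def e {G : Type*} [DecidableEq G] {k : Type*} [Zero k] [One k] (g : G) : G → k :=
  fun q => if q = g then 1 else 0

section Translation

variable {G : Type*} [Group G] {k : Type*}

/-- `(ρ_h f)(q) = f (q h⁻¹)`. [cite: LyndonSchupp2001, Ch. II §3] -/
theorem rt_apply (h : G) (f : G → k) (q : G) : rt h f q = f (q * h⁻¹) := rfl
/-- `(λ_g f)(q) = f (g⁻¹ q)`. [cite: LyndonSchupp2001, Ch. II §3] -/
theorem lt_apply (g : G) (f : G → k) (q : G) : lt g f q = f (g⁻¹ * q) := rfl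

/-- `ρ_1 = id`. [cite: LyndonSchupp2001, Ch. II §3] -/
theorem rt_one (f : G → k) : rt (1 : G) f = f := by
  funext q; simp [rt_apply]

/-- `ρ_{h h'} = ρ_{h'} ∘ ρ_h` (right translations compose contravariantly, as `f·(hh') = (f·h)·h'`). [cite: LyndonSchupp2001, Ch. II §3] -/
theorem rt_mul (h h' : G) (f : G → k) : rt (h * h') f = rt h' (rt h f) := by
  funext q; simp [rt_apply, mul_assoc]

/-- `λ_1 = id`. [cite: LyndonSchupp2001, Ch. II §3] -/
theorem lt_one (f : G → k) : lt (1 : G) f = f := by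
  funext q; simp [lt_apply]

/-- `λ_{g g'} = λ_g ∘ λ_{g'}`. [cite: LyndonSchupp2001, Ch. II §3] -/
theorem lt_mul (g g' : G) (f : G → k) : lt (g * g') f = lt g (lt g' f) := by
  funext q; simp [lt_apply, mul_assoc]

/-- Left and right translations commute. [cite: LyndonSchupp2001, Ch. II §3] -/
theorem lt_rt (g h : G) (f : G → k) : lt g (rt h f) = rt h (lt g f) := by
  funext q; simp [lt_apply, rt_apply, mul_assoc]

/-- `ρ_h e_g = e_{g h}` (in `k[G]`: `g · h = gh`). [cite: LyndonSchupp2001, Ch. II §3] -/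
theorem rt_e [DecidableEq G] [Zero k] [One k] (h g : G) : rt h (e g : G → k) = e (g * h) := by
  funext q; simp [rt_apply, e, mul_inv_eq_iff_eq_mul]

/-- `λ_{g'} e_g = e_{g' g}`. [cite: LyndonSchupp2001, Ch. II §3] -/
theorem lt_e [DecidableEq G] [Zero k] [One k] (g' g : G) : lt g' (e g : G → k) = e (g' * g) := by
  funext q; simp [lt_apply, e, inv_mul_eq_iff_eq_mul]

end Translation

section Additive

variable {G : Type*} [Group G] {k : Type*} [AddCommGroup k]

/-- `ρ_h` is additive. [cite: LyndonSchupp2001, Ch. II §3] -/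
theorem rt_add (h : G) (f f' : G → k) : rt h (f + f') = rt h f + rt h f' := rfl
/-- `ρ_h` commutes with subtraction. [cite: LyndonSchupp2001, Ch. II §3] -/
theorem rt_sub (h : G) (f f' : G → k) : rt h (f - f') = rt h f - rt h f' := rfl
/-- `ρ_h` commutes with negation. [cite: LyndonSchupp2001, Ch. II §3] -/
theorem rt_neg (h : G) (f : G → k) : rt h (-f) = -rt h f := rfl
/-- `ρ_h 0 = 0`. [cite: LyndonSchupp2001, Ch. II §3] -/
theorem rt_zero (h : G) : rt h (0 : G → k) = 0 := rfl
/-- `λ_g` is additive. [cite: LyndonSchupp2001, Ch. II §3] -/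
theorem lt_add (g : G) (f f' : G → k) : lt g (f + f') = lt g f + lt g f' := rfl
/-- `λ_g` commutes with subtraction. [cite: LyndonSchupp2001, Ch. II §3] -/
theorem lt_sub (g : G) (f f' : G → k) : lt g (f - f') = lt g f - lt g f' := rfl
/-- `λ_g` commutes with negation. [cite: LyndonSchupp2001, Ch. II §3] -/
theorem lt_neg (g : G) (f : G → k) : lt g (-f) = -lt g f := rfl
/-- `λ_g 0 = 0`. [cite: LyndonSchupp2001, Ch. II §3] -/
theorem lt_zero (g : G) : lt g (0 : G → k) = 0 := rfl

/-- `ρ_h` commutes with finite sums. [cite: LyndonSchupp2001, Ch. II §3] -/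
theorem rt_sum {ι : Type*} (s : Finset ι) (h : G) (f : ι → G → k) :
    rt h (∑ j ∈ s, f j) = ∑ j ∈ s, rt h (f j) := by
  funext q; simp [rt_apply, Finset.sum_apply]

/-- `λ_g` commutes with finite sums. [cite: LyndonSchupp2001, Ch. II §3] -/
theorem lt_sum {ι : Type*} (s : Finset ι) (g : G) (f : ι → G → k) :
    lt g (∑ j ∈ s, f j) = ∑ j ∈ s, lt g (f j) := by
  funext q; simp [lt_apply, Finset.sum_apply]

end Additive

/-- Coefficient sum over a finite set. [cite: LyndonSchupp2001, Ch. II §3] -/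
def csum {G : Type*} (S : Finset G) {k : Type*} [AddCommMonoid k] : (G → k) →+ k where
  toFun f := ∑ q ∈ S, f q
  map_zero' := by simp
  map_add' f f' := Finset.sum_add_distrib

/-- The coefficient sum over `S` is `Σ_{q ∈ S} f q`. [cite: LyndonSchupp2001, Ch. II §3] -/
theorem csum_apply {G : Type*} (S : Finset G) {k : Type*} [AddCommMonoid k] (f : G → k) :
    csum S f = ∑ q ∈ S, f q := rfl

/-- Reindexing: the coefficient sum of `ρ_h f` over `S` is the coefficient sum of `f` over `S·h⁻¹` (any `T` with `q ∈ S ↔ q h⁻¹ ∈ T`). [cite: LyndonSchupp2001, Ch. II §3] -/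
theorem csum_rt {G : Type*} [Group G] {k : Type*} [AddCommMonoid k] (S T : Finset G) (h : G)
    (hST : ∀ q, q ∈ S ↔ q * h⁻¹ ∈ T) (f : G → k) : csum S (rt h f) = csum T f := by
  simp only [csum_apply, rt_apply]
  exact Finset.sum_nbij' (· * h⁻¹) (· * h) (fun q hq => (hST q).1 hq)
    (fun q hq => (hST _).2 (by simpa using hq)) (fun q _ => by simp) (fun q _ => by simp) (fun _ _ => rfl)

/-- The coefficient sum of an indicator: `csum S e_g = [g ∈ S]`. [cite: LyndonSchupp2001, Ch. II §3] -/
theorem csum_e {G : Type*} [DecidableEq G] (S : Finset G) {k : Type*} [AddCommMonoidWithOne k] (g : G) :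
    csum S (e g : G → k) = if g ∈ S then 1 else 0 := by
  simp only [csum_apply, e]
  rw [Finset.sum_ite_eq' S g]

/-- **The coset-sum test (finite shadow of Bass–Serre).**  Let `H ≤ G` contain `B` and `A B A⁻¹`, `k` a field
with `(M : k) ≠ 0`.  If `(f₁, f₂)` is a path chain from `1` to `X` (`ρ_A f₁ - f₁ + ρ_B f₂ - f₂ = e_X - e_1`, the Fox
fundamental formula reduced to `G`) and `Σ_{j<M} ρ_{A B^j} f₁ = 0`, then `X ∈ H`.  Proof: the coefficient-sum
functional of the right-`B`-stable sets `H` and `H·A` kills `ρ_A f₁` (sum the hypothesis: `M · csum = 0`), hence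
`csum_H f₁ = csum_{HA} (ρ_A f₁) = 0`; applying `csum_H` to the boundary identity leaves `[X ∈ H] - 1 = 0`.
[cite: LyndonSchupp2001, Ch. II §3] -/
theorem mem_of_fox_chain {G : Type*} [Group G] [Fintype G] [DecidableEq G] {k : Type*} [Field k]
    (H : Subgroup G) [DecidablePred (· ∈ H)] {A B X : G} (hB : B ∈ H) (hAB : A * B * A⁻¹ ∈ H) {M : ℕ}
    (hM : (M : k) ≠ 0) {f₁ f₂ : G → k}
    (hE : rt A f₁ - f₁ + (rt B f₂ - f₂) = e X - e 1)
    (hΘ : ∑ j ∈ Finset.range M, rt (A * B ^ j) f₁ = 0) : X ∈ H := by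
  -- the two finite sets `H` and `H·A`
  set SH : Finset G := Finset.univ.filter (· ∈ H) with hSH
  set SA : Finset G := Finset.univ.filter (fun q => q * A⁻¹ ∈ H) with hSA
  have memSH : ∀ q, q ∈ SH ↔ q ∈ H := fun q => by simp [hSH]
  have memSA : ∀ q, q ∈ SA ↔ q * A⁻¹ ∈ H := fun q => by simp [hSA]
  -- both are stable under right translation by `B`
  have hSH_B : ∀ q, q ∈ SH ↔ q * B⁻¹ ∈ SH := fun q => by
    rw [memSH, memSH]
    constructor
    · intro hq; exact H.mul_mem hq (H.inv_mem hB)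
    · intro hq
      have := H.mul_mem hq hB
      rwa [inv_mul_cancel_right] at this
  have hABinv : A * B⁻¹ * A⁻¹ ∈ H := by
    have : (A * B * A⁻¹)⁻¹ = A * B⁻¹ * A⁻¹ := by group
    rw [← this]; exact H.inv_mem hAB
  have hSA_B : ∀ q, q ∈ SA ↔ q * B⁻¹ ∈ SA := fun q => by
    rw [memSA, memSA]
    have h1 : q * B⁻¹ * A⁻¹ = q * A⁻¹ * (A * B⁻¹ * A⁻¹) := by group
    rw [h1]
    constructor
    · intro hq; exact H.mul_mem hq hABinv
    · intro hq
      have := H.mul_mem hq (H.inv_mem hABinv)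
      rwa [mul_inv_cancel_right] at this
  -- key: the coefficient sums of `ρ_A f₁` over a right-`B`-stable set vanish
  have key : ∀ S : Finset G, (∀ q, q ∈ S ↔ q * B⁻¹ ∈ S) → csum S (rt A f₁) = 0 := by
    intro S hS
    have hj : ∀ j : ℕ, csum S (rt (A * B ^ j) f₁) = csum S (rt A f₁) := by
      intro j
      induction j with
      | zero => rw [pow_zero, mul_one]
      | succ j ih => rw [pow_succ, ← mul_assoc, rt_mul, csum_rt S S B hS, ih]
    have h := congrArg (csum S) hΘ
    rw [map_sum, map_zero] at h
    simp_rw [hj] at h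
    rw [Finset.sum_const, Finset.card_range, nsmul_eq_mul] at h
    exact (mul_eq_zero.mp h).resolve_left hM
  have h1 : csum SH (rt A f₁) = 0 := key SH hSH_B
  have h2 : csum SH f₁ = 0 := by
    rw [← csum_rt SA SH A (fun q => by rw [memSA, memSH]) f₁]
    exact key SA hSA_B
  have h3 : csum SH (rt B f₂) = csum SH f₂ := csum_rt SH SH B hSH_B f₂
  have h := congrArg (csum SH) hE
  rw [map_add, map_sub, map_sub, map_sub, h1, h2, h3] at h
  simp only [sub_self, zero_add, csum_e, memSH, H.one_mem, if_true] at h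
  by_contra hX
  rw [if_neg hX, zero_sub, zero_eq_neg] at h
  exact one_ne_zero h

/-! ### The Fox group `W = (k^G × k^G) ⋊ G` -/

section FoxGroup

variable {G : Type*} [Group G] {k : Type*} [CommRing k]

/-- The pair module `k^G × k^G`. [cite: LyndonSchupp2001, Ch. II §3] -/
abbrev V2 (G : Type*) (k : Type*) : Type _ := (G → k) × (G → k)

/-- Left translation on pairs, as a multiplicative automorphism of `Multiplicative (k^G × k^G)`. [cite: LyndonSchupp2001, Ch. II §3] -/
def foxAut (g : G) : MulAut (Multiplicative (V2 G k)) where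
  toFun v := Multiplicative.ofAdd (lt g (Multiplicative.toAdd v).1, lt g (Multiplicative.toAdd v).2)
  invFun v := Multiplicative.ofAdd (lt g⁻¹ (Multiplicative.toAdd v).1, lt g⁻¹ (Multiplicative.toAdd v).2)
  left_inv v := by
    simp only [toAdd_ofAdd, ← lt_mul, inv_mul_cancel, lt_one, Prod.mk.eta, ofAdd_toAdd]
  right_inv v := by
    simp only [toAdd_ofAdd, ← lt_mul, mul_inv_cancel, lt_one, Prod.mk.eta, ofAdd_toAdd]
  map_mul' v w := by
    simp only [toAdd_mul, Prod.fst_add, Prod.snd_add, lt_add, ← ofAdd_add, Prod.mk_add_mk]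

/-- `foxAut g` acts by left translation on both components. [cite: LyndonSchupp2001, Ch. II §3] -/
theorem foxAut_apply (g : G) (v : Multiplicative (V2 G k)) :
    foxAut g v = Multiplicative.ofAdd (lt g (Multiplicative.toAdd v).1, lt g (Multiplicative.toAdd v).2) := rfl

/-- The action of `G` on `Multiplicative (k^G × k^G)` by left translation. [cite: LyndonSchupp2001, Ch. II §3] -/
def foxAct : G →* MulAut (Multiplicative (V2 G k)) where
  toFun := foxAut
  map_one' := by
    refine MulEquiv.ext fun v => ?_
    rw [foxAut_apply, MulAut.one_apply, lt_one, lt_one, Prod.mk.eta, ofAdd_toAdd]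
  map_mul' g g' := by
    refine MulEquiv.ext fun v => ?_
    rw [MulAut.mul_apply, foxAut_apply, foxAut_apply, foxAut_apply, toAdd_ofAdd, lt_mul, lt_mul]

/-- The action of `g` on `ofAdd (f₁, f₂)` is `ofAdd (λ_g f₁, λ_g f₂)`. [cite: LyndonSchupp2001, Ch. II §3] -/
theorem foxAct_apply (g : G) (v : V2 G k) :
    foxAct g (Multiplicative.ofAdd v) = Multiplicative.ofAdd (lt g v.1, lt g v.2) := rfl

/-- Additive form of `foxAct_apply`. [cite: LyndonSchupp2001, Ch. II §3] -/
theorem toAdd_foxAct (g : G) (v : Multiplicative (V2 G k)) :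
    Multiplicative.toAdd (foxAct g v) = (lt g (Multiplicative.toAdd v).1, lt g (Multiplicative.toAdd v).2) := rfl

/-- The Fox group `W = (k^G × k^G) ⋊ G` — the target of the Fox derivations of `F(a,b) → G` reduced to `G`
(a finite group when `G` and `k` are finite). [cite: LyndonSchupp2001, Ch. II §3] -/
abbrev W (G : Type*) [Group G] (k : Type*) [CommRing k] : Type _ :=
  Multiplicative (V2 G k) ⋊[foxAct] G

/-- The image of the first free generator: `(e_a, A) = ((𝟙, 0), A)`. [cite: LyndonSchupp2001, Ch. II §3] -/
def wa [DecidableEq G] (A : G) : W G k := ⟨Multiplicative.ofAdd (e 1, 0), A⟩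

/-- The image of the second free generator: `(e_b, B) = ((0, 𝟙), B)`. [cite: LyndonSchupp2001, Ch. II §3] -/
def wb [DecidableEq G] (B : G) : W G k := ⟨Multiplicative.ofAdd (0, e 1), B⟩

/-- The linear map `Θ (f₁, f₂) = (f₁, f₂ + ∑_{j<M} ρ_{A B^j} f₁)` as a group endomorphism of `W`. [cite: LyndonSchupp2001, Ch. II §3] -/
def thetaHom (A B : G) (M : ℕ) : W G k →* W G k where
  toFun w := ⟨Multiplicative.ofAdd ((Multiplicative.toAdd w.left).1,
      (Multiplicative.toAdd w.left).2 + ∑ j ∈ Finset.range M, rt (A * B ^ j) (Multiplicative.toAdd w.left).1),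
      w.right⟩
  map_one' := by
    refine SemidirectProduct.ext ?_ rfl
    show Multiplicative.ofAdd (((0 : V2 G k)).1, (0 : V2 G k).2 +
      ∑ j ∈ Finset.range M, rt (A * B ^ j) (0 : V2 G k).1) = Multiplicative.ofAdd 0
    simp only [Prod.fst_zero, Prod.snd_zero, rt_zero, Finset.sum_const_zero, add_zero, Prod.mk_zero_zero]
  map_mul' w w' := by
    refine SemidirectProduct.ext ?_ rfl
    apply Multiplicative.toAdd.injective
    simp only [SemidirectProduct.mul_left, toAdd_mul, toAdd_ofAdd, toAdd_foxAct, Prod.fst_add,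
      Prod.snd_add, Prod.mk_add_mk, rt_add, Finset.sum_add_distrib, lt_add, lt_sum, lt_rt]
    refine Prod.ext rfl ?_
    simp only
    abel

/-- Unfolding `thetaHom`. [cite: LyndonSchupp2001, Ch. II §3] -/
theorem thetaHom_apply (A B : G) (M : ℕ) (w : W G k) :
    thetaHom A B M w = ⟨Multiplicative.ofAdd ((Multiplicative.toAdd w.left).1,
      (Multiplicative.toAdd w.left).2 + ∑ j ∈ Finset.range M, rt (A * B ^ j) (Multiplicative.toAdd w.left).1),
      w.right⟩ := rfl

/-- The Fox boundary `∂(f₁,f₂) = ρ_A f₁ - f₁ + (ρ_B f₂ - f₂)`. [cite: LyndonSchupp2001, Ch. II §3] -/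
def bd (A B : G) (v : V2 G k) : G → k := rt A v.1 - v.1 + (rt B v.2 - v.2)

/-- The Fox boundary is additive. [cite: LyndonSchupp2001, Ch. II §3] -/
theorem bd_add (A B : G) (v w : V2 G k) : bd A B (v + w) = bd A B v + bd A B w := by
  simp only [bd, Prod.fst_add, Prod.snd_add, rt_add]; abel

/-- The Fox boundary commutes with negation. [cite: LyndonSchupp2001, Ch. II §3] -/
theorem bd_neg (A B : G) (v : V2 G k) : bd A B (-v) = -bd A B v := by
  simp only [bd, Prod.fst_neg, Prod.snd_neg, rt_neg]; abel

/-- The Fox boundary commutes with left translation (it is given by RIGHT multiplications). [cite: LyndonSchupp2001, Ch. II §3] -/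
theorem bd_lt (A B g : G) (v : V2 G k) : bd A B (lt g v.1, lt g v.2) = lt g (bd A B v) := by
  simp only [bd, lt_add, lt_sub, lt_rt]

/-- The subgroup `{(v, q) : ∂ v = e_q - e_1}` of the Fox group (the "path chains"). [cite: LyndonSchupp2001, Ch. II §3] -/
def pathSub [DecidableEq G] (A B : G) : Subgroup (W G k) where
  carrier := {w | bd A B (Multiplicative.toAdd w.left) = e w.right - e 1}
  one_mem' := by
    show bd A B (Multiplicative.toAdd (1 : W G k).left) = e (1 : W G k).right - e 1
    show bd A B (0 : V2 G k) = e (1 : G) - e 1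
    simp only [bd, Prod.fst_zero, Prod.snd_zero, rt_zero, sub_self, add_zero]
  mul_mem' {w w'} hw hw' := by
    change bd A B _ = _ at hw
    change bd A B _ = _ at hw'
    show bd A B (Multiplicative.toAdd (w * w').left) = e (w * w').right - e 1
    rw [SemidirectProduct.mul_left, SemidirectProduct.mul_right, toAdd_mul, bd_add, hw, toAdd_foxAct,
      bd_lt, hw', lt_sub, lt_e, lt_e, mul_one]
    abel
  inv_mem' {w} hw := by
    change bd A B _ = _ at hw
    show bd A B (Multiplicative.toAdd w⁻¹.left) = e w⁻¹.right - e 1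
    rw [SemidirectProduct.inv_left, SemidirectProduct.inv_right, toAdd_foxAct, toAdd_inv, bd_lt, bd_neg, hw,
      lt_neg, lt_sub, lt_e, lt_e, mul_one, inv_mul_cancel]
    abel

/-- Membership in the path-chain subgroup, unfolded. [cite: LyndonSchupp2001, Ch. II §3] -/
theorem mem_pathSub_iff [DecidableEq G] (A B : G) (w : W G k) :
    w ∈ pathSub A B ↔ bd A B (Multiplicative.toAdd w.left) = e w.right - e 1 := Iff.rfl

/-- The edge chain `e_a` is a path chain from `1` to `A` (`∂ e_a = A - 1`). [cite: LyndonSchupp2001, Ch. II §3] -/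
theorem wa_mem_pathSub [DecidableEq G] (A B : G) : (wa A : W G k) ∈ pathSub A B := by
  rw [mem_pathSub_iff, wa]
  simp only [toAdd_ofAdd, bd, rt_zero, sub_zero, add_zero, rt_e, one_mul]

/-- The edge chain `e_b` is a path chain from `1` to `B` (`∂ e_b = B - 1`). [cite: LyndonSchupp2001, Ch. II §3] -/
theorem wb_mem_pathSub [DecidableEq G] (A B : G) : (wb B : W G k) ∈ pathSub A B := by
  rw [mem_pathSub_iff, wb]
  simp only [toAdd_ofAdd, bd, rt_zero, sub_zero, zero_add, rt_e, one_mul]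

/-- Powers of `wb`: `wb^j = ((0, ∑_{l<j} e_{B^l}), B^j)`. [cite: LyndonSchupp2001, Ch. II §3] -/
theorem wb_pow [DecidableEq G] (B : G) (j : ℕ) :
    (wb B : W G k) ^ j = ⟨Multiplicative.ofAdd (0, ∑ l ∈ Finset.range j, e (B ^ l)), B ^ j⟩ := by
  induction j with
  | zero =>
    refine SemidirectProduct.ext ?_ ?_
    · show (1 : Multiplicative (V2 G k)) = Multiplicative.ofAdd (0, ∑ l ∈ Finset.range 0, e (B ^ l))
      rw [Finset.sum_range_zero]
      rfl
    · show (1 : G) = B ^ 0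
      rw [pow_zero]
  | succ j ih =>
    rw [pow_succ, ih, wb]
    refine SemidirectProduct.ext ?_ ?_
    · rw [SemidirectProduct.mul_left, foxAct_apply, ← ofAdd_add, Prod.mk_add_mk]
      show Multiplicative.ofAdd (0 + lt (B ^ j) 0, ∑ l ∈ Finset.range j, e (B ^ l) + lt (B ^ j) (e 1)) = _
      rw [lt_zero, lt_e, add_zero, mul_one, Finset.sum_range_succ]
    · rw [SemidirectProduct.mul_right, pow_succ]

/-- `Θ (wa) = wa · wb^M` provided `B^M = 1`: on Fox chains, `Θ` is the substitution `a ↦ a b^M`. [cite: LyndonSchupp2001, Ch. II §3] -/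
theorem thetaHom_wa [DecidableEq G] (A B : G) (M : ℕ) (hBM : B ^ M = 1) :
    thetaHom A B M (wa A : W G k) = wa A * wb B ^ M := by
  rw [wb_pow, thetaHom_apply, wa]
  refine SemidirectProduct.ext ?_ ?_
  · rw [SemidirectProduct.mul_left, foxAct_apply, ← ofAdd_add, Prod.mk_add_mk]
    simp only [toAdd_ofAdd, lt_zero, lt_sum, lt_e, add_zero, zero_add, rt_e, one_mul]
  · show A = A * B ^ M
    rw [hBM, mul_one]

/-- `Θ (wb) = wb` (the substitution fixes `b`). [cite: LyndonSchupp2001, Ch. II §3] -/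
theorem thetaHom_wb [DecidableEq G] (A B : G) (M : ℕ) : thetaHom A B M (wb B : W G k) = wb B := by
  rw [thetaHom_apply, wb]
  refine SemidirectProduct.ext ?_ rfl
  simp only [toAdd_ofAdd, rt_zero, Finset.sum_const_zero, add_zero]

/-- A fixed point of `Θ` has `∑_{j<M} ρ_{A B^j} f₁ = 0`. [cite: LyndonSchupp2001, Ch. II §3] -/
theorem sum_rt_eq_zero_of_thetaHom_eq (A B : G) (M : ℕ) (w : W G k) (hw : thetaHom A B M w = w) :
    ∑ j ∈ Finset.range M, rt (A * B ^ j) (Multiplicative.toAdd w.left).1 = 0 := by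
  have h := congrArg (fun z : W G k => (Multiplicative.toAdd z.left).2) hw
  simp only [thetaHom_apply, toAdd_ofAdd] at h
  simpa using h

end FoxGroup


/-! ### Appended: the coset-sum test over a commutative ring of coefficients -/

/-- **The coset-sum test with coefficients in a commutative ring** (e.g. `ℤ/q^e`, needed when the substitution
exponent `M` is only known to be non-zero modulo a prime POWER): with the hypotheses of `mem_of_fox_chain` but `k`
any commutative ring in which `(M : k) ≠ 0`, still `X ∈ H`.  Proof: the coefficient-sum functional gives
`M · csum_H(ρ_A f₁) = 0` and `M · csum_H(f₁) = 0`; applied to the boundary identity this yields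
`M · ([X ∈ H] - 1) = 0`, so `X ∉ H` would force `(M : k) = 0`. [cite: LyndonSchupp2001, Ch. II §3] -/
theorem mem_of_fox_chain_of_natCast_ne_zero {G : Type*} [Group G] [Fintype G] [DecidableEq G] {k : Type*}
    [CommRing k] (H : Subgroup G) [DecidablePred (· ∈ H)] {A B X : G} (hB : B ∈ H) (hAB : A * B * A⁻¹ ∈ H)
    {M : ℕ} (hM : (M : k) ≠ 0) {f₁ f₂ : G → k}
    (hE : rt A f₁ - f₁ + (rt B f₂ - f₂) = e X - e 1)
    (hΘ : ∑ j ∈ Finset.range M, rt (A * B ^ j) f₁ = 0) : X ∈ H := by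
  -- the two finite sets `H` and `H·A`
  set SH : Finset G := Finset.univ.filter (· ∈ H) with hSH
  set SA : Finset G := Finset.univ.filter (fun q => q * A⁻¹ ∈ H) with hSA
  have memSH : ∀ q, q ∈ SH ↔ q ∈ H := fun q => by simp [hSH]
  have memSA : ∀ q, q ∈ SA ↔ q * A⁻¹ ∈ H := fun q => by simp [hSA]
  have hSH_B : ∀ q, q ∈ SH ↔ q * B⁻¹ ∈ SH := fun q => by
    rw [memSH, memSH]
    constructor
    · intro hq; exact H.mul_mem hq (H.inv_mem hB)
    · intro hq
      have := H.mul_mem hq hB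
      rwa [inv_mul_cancel_right] at this
  have hABinv : A * B⁻¹ * A⁻¹ ∈ H := by
    have : (A * B * A⁻¹)⁻¹ = A * B⁻¹ * A⁻¹ := by group
    rw [← this]; exact H.inv_mem hAB
  have hSA_B : ∀ q, q ∈ SA ↔ q * B⁻¹ ∈ SA := fun q => by
    rw [memSA, memSA]
    have h1 : q * B⁻¹ * A⁻¹ = q * A⁻¹ * (A * B⁻¹ * A⁻¹) := by group
    rw [h1]
    constructor
    · intro hq; exact H.mul_mem hq hABinv
    · intro hq
      have := H.mul_mem hq (H.inv_mem hABinv)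
      rwa [mul_inv_cancel_right] at this
  -- key: `M ·` the coefficient sum of `ρ_A f₁` over a right-`B`-stable set vanishes
  have key : ∀ S : Finset G, (∀ q, q ∈ S ↔ q * B⁻¹ ∈ S) → (M : k) * csum S (rt A f₁) = 0 := by
    intro S hS
    have hj : ∀ j : ℕ, csum S (rt (A * B ^ j) f₁) = csum S (rt A f₁) := by
      intro j
      induction j with
      | zero => rw [pow_zero, mul_one]
      | succ j ih => rw [pow_succ, ← mul_assoc, rt_mul, csum_rt S S B hS, ih]
    have h := congrArg (csum S) hΘ
    rw [map_sum, map_zero] at h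
    simp_rw [hj] at h
    rwa [Finset.sum_const, Finset.card_range, nsmul_eq_mul] at h
  have h1 : (M : k) * csum SH (rt A f₁) = 0 := key SH hSH_B
  have h2 : (M : k) * csum SH f₁ = 0 := by
    rw [← csum_rt SA SH A (fun q => by rw [memSA, memSH]) f₁]
    exact key SA hSA_B
  have h3 : csum SH (rt B f₂) = csum SH f₂ := csum_rt SH SH B hSH_B f₂
  have h := congrArg (fun z => (M : k) * csum SH z) hE
  simp only [map_add, map_sub, mul_sub, h1, h2, h3, sub_self, add_zero, csum_e, memSH, H.one_mem,
    if_true] at h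
  by_contra hX
  rw [if_neg hX, mul_zero, zero_sub, mul_one, zero_eq_neg] at h
  exact hM h

end Literature.GroupTheory.CombinatorialGroupTheory.FoxChain
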